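/-
Copyright (c) 2026 the pub-hodgecm-mathlib formalisation cell (harness21).  Prover seat hodgecm-mathlib-F0P2-p02 (g10): road «S3-tree» (LEAD F0P3a-plan (g11) WORD T10-2;
architect A-p16 (g29) A-63 (1): «T2-S apartment ∕ tube per period STANDS»), brick T2-S, FILE 4b = THE APARTMENT IS A PATH; 2026-09-01.
-/
import Literature.NumberTheory.Automorphic.UnitaryLatticeTreeApartment     -- ★ T1 (B-p14 (g35)): the apartment vertices `L_a`, `L′_a` are vertices; `latticeGraph_adj_iff` (via Defs)
import Literature.NumberTheory.Automorphic.UnitaryLatticeTreeSelfDualFrames -- ★ T1 (B-p14 (g35)): `mem_latt_diagonal_iff`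
import HarnessLib

/-!
# The apartment of the split torus of `U(3)` is a bi-infinite path `… — L′_a — L_a — L′_{a+1} — L_{a+1} — …` in the lattice graph (Bruhat–Tits 1972 §10; Serre, *Trees* I.6.4, II.1.1)

Topic `NumberTheory/Automorphic`; namespace `Literature.NumberTheory.Automorphic.UnitaryLatticeTree` (T1a's).  THEOREMS ONLY: no definition, no named fact, no instance, no
notation, no `sorry`.  Cell `pub/hodgecm-mathlib` (D-0151), crux H413 = `stmt-HodgeConjecture-24833`; road «S3-tree» (target `stub_N6nsS3id` of «N6nsGerm» ED. 1.15), brick **T2-S**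
(holder F0P2-p02 (g10); ★ FILE 0 `…Stabilizer` p845432, ★ FILE 4a `…ApartmentTorus` p845484), FILE 4b.  HONEST LABEL: HC_CM is proved only modulo the 2 remaining named inputs
(hLiu418 24832, h413 24833) until rung 0 closes; nothing printed is asserted here — lattice algebra over a valuation ring.

THE MATHEMATICS (frame `J₀ = antidiag(1,1,1)`, `L_a = latt diag(ϖ^a, 1, ϖ^{−a})` self-dual, `L′_a = latt diag(ϖ^a, 1, ϖ^{1−a})` of type `2`, ★ B-p14 `UnitaryLatticeTreeApartment`; `ϖ` a
uniformiser, `|ϖ| = exp(−1)`).  Diagonal lattices compare entrywise by valuation (★ `mem_latt_diagonal_iff`), so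
* §1 (rank `N`) `latt_diagonal_le_latt_diagonal_iff`: `latt diag(d) ≤ latt diag(d′) ⟺ ∀ i, |d_i| ≤ |d′_i|`;
* §2 **`latt_apartment_two_lt_selfDual`: `L′_a < L_a`** and **`latt_apartment_two_succ_lt_selfDual`: `L′_{a+1} < L_a`** (strict: the third, resp. first, column witnesses it);
* §3 in the lattice graph (adjacency = strict comparability, ★ `latticeGraph_adj_iff`): **`latticeGraph_adj_apartment_two_selfDual`** (`L′_a — L_a`) and
  **`latticeGraph_adj_apartment_selfDual_two_succ`** (`L_a — L′_{a+1}`) — the apartment is the bi-infinite PATH `… — L′_a — L_a — L′_{a+1} — L_{a+1} — …`, translated by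
  `t_c` (★ FILE 4a `mapGL_latt_apartment_{selfDual,two}_translate`) and fixed pointwise by the compact part (★ FILE 4a `…_of_units`): the AXIS datum of ★ `TreeActionAxis*` ∕ the
  infinite subtree `Y` with fundamental domain `{L_0, L′_1}` of ★ p08 `TreeHereditaryLayerCount` for the per-period tube counts of T2-S.

## References
* [BruhatTits1972] F. Bruhat, J. Tits, *Groupes réductifs sur un corps local I*, Publ. Math. IHÉS 41 (1972), §10 (apartments in the lattice model).
* [Serre1980Trees] J.-P. Serre, *Trees* (1980), Ch. I §6.4 (axis of a hyperbolic automorphism), Ch. II §1.1 (lattices, adjacency, the straight path of diagonal lattices).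
-/

set_option autoImplicit false

noncomputable section

open scoped Valued WithZero Matrix MatrixGroups

namespace Literature.NumberTheory.Automorphic.UnitaryLatticeTree

open Literature.NumberTheory.Automorphic Literature.NumberTheory.Automorphic.HermitianLattice
open Literature.NumberTheory.Automorphic.CartanUnique (uniformizer_ne_zero v_uniformizer_zpow)

variable {K : Type*} [Field K] [Valued K ℤᵐ⁰] {N : ℕ}

/-! ## §1 Diagonal lattices compare entrywise -/

/-- **`latt diag(d) ≤ latt diag(d′) ⟺ |d_i| ≤ |d′_i|` for all `i`** (`d_i, d′_i ≠ 0`). [cite: Serre1980Trees, II.1.1] -/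
theorem latt_diagonal_le_latt_diagonal_iff {d d' : Fin N → K} (hd : ∀ i, d i ≠ 0) (hd' : ∀ i, d' i ≠ 0) :
    latt (Matrix.diagonal d) ≤ latt (Matrix.diagonal d') ↔ ∀ i, Valued.v (d i) ≤ Valued.v (d' i) := by
  constructor
  · intro h i
    have hmem : (Pi.single i (d i) : Fin N → K) ∈ latt (Matrix.diagonal d) := by
      rw [mem_latt_diagonal_iff hd]
      intro j
      by_cases hij : j = i
      · subst hij; rw [Pi.single_eq_same]
      · rw [Pi.single_eq_of_ne hij, map_zero]; exact zero_le
    have := (mem_latt_diagonal_iff hd' _).1 (h hmem) i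
    rwa [Pi.single_eq_same] at this
  · intro h x hx
    rw [mem_latt_diagonal_iff hd] at hx
    rw [mem_latt_diagonal_iff hd']
    exact fun i => (hx i).trans (h i)

/-- Strictness criterion: `latt diag(d) < latt diag(d′)` iff entrywise `≤` and some entry `<`. [cite: Serre1980Trees, II.1.1] -/
theorem latt_diagonal_lt_latt_diagonal_of {d d' : Fin N → K} (hd : ∀ i, d i ≠ 0) (hd' : ∀ i, d' i ≠ 0)
    (hle : ∀ i, Valued.v (d i) ≤ Valued.v (d' i)) {i₀ : Fin N} (hlt : Valued.v (d i₀) < Valued.v (d' i₀)) :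
    latt (Matrix.diagonal d) < latt (Matrix.diagonal d') := by
  refine lt_of_le_of_ne ((latt_diagonal_le_latt_diagonal_iff hd hd').2 hle) fun heq => ?_
  have hge := (latt_diagonal_le_latt_diagonal_iff hd' hd).1 heq.symm.le i₀
  exact absurd hlt (not_lt.2 hge)

/-! ## §2 The apartment vertices: `L′_a < L_a` and `L′_{a+1} < L_a` -/

section Apartment

variable {ϖ : K}

/-- `|ϖ^m| ≤ |ϖ^n| ⟺ n ≤ m` for a uniformiser. [cite: Serre1980Trees, II.1.1] -/
theorem v_zpow_le_v_zpow_iff (hϖ : Valued.v ϖ = WithZero.exp (-1 : ℤ)) (m n : ℤ) : Valued.v (ϖ ^ m) ≤ Valued.v (ϖ ^ n) ↔ n ≤ m := by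
  rw [v_uniformizer_zpow hϖ, v_uniformizer_zpow hϖ, WithZero.exp_le_exp]; omega

/-- `|ϖ^m| < |ϖ^n| ⟺ n < m` for a uniformiser. [cite: Serre1980Trees, II.1.1] -/
theorem v_zpow_lt_v_zpow_iff (hϖ : Valued.v ϖ = WithZero.exp (-1 : ℤ)) (m n : ℤ) : Valued.v (ϖ ^ m) < Valued.v (ϖ ^ n) ↔ n < m := by
  rw [v_uniformizer_zpow hϖ, v_uniformizer_zpow hϖ, WithZero.exp_lt_exp]; omega

/-- **`L′_a < L_a`**: `latt diag(ϖ^a, 1, ϖ^{1−a}) < latt diag(ϖ^a, 1, ϖ^{−a})` (the third entry drops by one valuation step). [cite: BruhatTits1972, §10] [cite: Serre1980Trees, II.1.1] -/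
theorem latt_apartment_two_lt_selfDual (hϖ : Valued.v ϖ = WithZero.exp (-1 : ℤ)) (a : ℤ) :
    latt (Matrix.diagonal ![ϖ ^ a, (1 : K), ϖ ^ (1 - a)]) < latt (Matrix.diagonal ![ϖ ^ a, (1 : K), ϖ ^ (-a)]) := by
  have hϖ0 := uniformizer_ne_zero hϖ
  refine latt_diagonal_lt_latt_diagonal_of (fun i => ?_) (fun i => ?_) (fun i => ?_) (i₀ := 2) ?_
  · fin_cases i
    · exact zpow_ne_zero _ hϖ0
    · exact one_ne_zero
    · exact zpow_ne_zero _ hϖ0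
  · fin_cases i
    · exact zpow_ne_zero _ hϖ0
    · exact one_ne_zero
    · exact zpow_ne_zero _ hϖ0
  · fin_cases i
    · exact le_rfl
    · exact le_rfl
    · change Valued.v (ϖ ^ (1 - a)) ≤ Valued.v (ϖ ^ (-a))
      rw [v_zpow_le_v_zpow_iff hϖ]; omega
  · change Valued.v (ϖ ^ (1 - a)) < Valued.v (ϖ ^ (-a))
    rw [v_zpow_lt_v_zpow_iff hϖ]; omega

/-- **`L′_{a+1} < L_a`**: `latt diag(ϖ^{a+1}, 1, ϖ^{1−(a+1)}) < latt diag(ϖ^a, 1, ϖ^{−a})` (the first entry drops by one valuation step). [cite: BruhatTits1972, §10] [cite: Serre1980Trees, II.1.1] -/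
theorem latt_apartment_two_succ_lt_selfDual (hϖ : Valued.v ϖ = WithZero.exp (-1 : ℤ)) (a : ℤ) :
    latt (Matrix.diagonal ![ϖ ^ (a + 1), (1 : K), ϖ ^ (1 - (a + 1))]) < latt (Matrix.diagonal ![ϖ ^ a, (1 : K), ϖ ^ (-a)]) := by
  have hϖ0 := uniformizer_ne_zero hϖ
  refine latt_diagonal_lt_latt_diagonal_of (fun i => ?_) (fun i => ?_) (fun i => ?_) (i₀ := 0) ?_
  · fin_cases i
    · exact zpow_ne_zero _ hϖ0
    · exact one_ne_zero
    · exact zpow_ne_zero _ hϖ0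
  · fin_cases i
    · exact zpow_ne_zero _ hϖ0
    · exact one_ne_zero
    · exact zpow_ne_zero _ hϖ0
  · fin_cases i
    · change Valued.v (ϖ ^ (a + 1)) ≤ Valued.v (ϖ ^ a)
      rw [v_zpow_le_v_zpow_iff hϖ]; omega
    · exact le_rfl
    · change Valued.v (ϖ ^ (1 - (a + 1))) ≤ Valued.v (ϖ ^ (-a))
      rw [v_zpow_le_v_zpow_iff hϖ]; omega
  · change Valued.v (ϖ ^ (a + 1)) < Valued.v (ϖ ^ a)
    rw [v_zpow_lt_v_zpow_iff hϖ]; omega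

/-! ## §3 The apartment is a path in the lattice graph of `J₀` -/

variable {σ : K →+* K}

/-- **The edge `L′_a — L_a`** of the lattice graph of `J₀` (`σ` an involution fixing the uniformiser `ϖ`). [cite: BruhatTits1972, §10] [cite: Serre1980Trees, II.1.1] -/
theorem latticeGraph_adj_apartment_two_selfDual (hσ : ∀ x, σ (σ x) = x) (hσϖ : σ ϖ = ϖ) (hϖ : Valued.v ϖ = WithZero.exp (-1 : ℤ)) (a : ℤ) :
    (latticeGraph σ ϖ ((StdForm.antidiagonal 3).over K)).Adj
      ⟨latt (Matrix.diagonal ![ϖ ^ a, (1 : K), ϖ ^ (1 - a)]),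
        ⟨2, isVertexLattice_two_latt_diagonal_zpow hσ hσϖ (by rw [hϖ]; exact le_of_lt (WithZero.exp_lt_exp.2 (by norm_num) |>.trans_eq WithZero.exp_zero))
          (uniformizer_ne_zero hϖ) a⟩⟩
      ⟨latt (Matrix.diagonal ![ϖ ^ a, (1 : K), ϖ ^ (-a)]),
        ⟨0, isSelfDualLattice_latt_diagonal_zpow hσ hσϖ (by rw [hϖ]; exact le_of_lt (WithZero.exp_lt_exp.2 (by norm_num) |>.trans_eq WithZero.exp_zero))
          (uniformizer_ne_zero hϖ) a⟩⟩ := by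
  rw [latticeGraph_adj_iff]
  exact Or.inl (latt_apartment_two_lt_selfDual hϖ a)

/-- **The edge `L_a — L′_{a+1}`** of the lattice graph of `J₀`. [cite: BruhatTits1972, §10] [cite: Serre1980Trees, II.1.1] -/
theorem latticeGraph_adj_apartment_selfDual_two_succ (hσ : ∀ x, σ (σ x) = x) (hσϖ : σ ϖ = ϖ) (hϖ : Valued.v ϖ = WithZero.exp (-1 : ℤ)) (a : ℤ) :
    (latticeGraph σ ϖ ((StdForm.antidiagonal 3).over K)).Adj
      ⟨latt (Matrix.diagonal ![ϖ ^ a, (1 : K), ϖ ^ (-a)]),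
        ⟨0, isSelfDualLattice_latt_diagonal_zpow hσ hσϖ (by rw [hϖ]; exact le_of_lt (WithZero.exp_lt_exp.2 (by norm_num) |>.trans_eq WithZero.exp_zero))
          (uniformizer_ne_zero hϖ) a⟩⟩
      ⟨latt (Matrix.diagonal ![ϖ ^ (a + 1), (1 : K), ϖ ^ (1 - (a + 1))]),
        ⟨2, isVertexLattice_two_latt_diagonal_zpow hσ hσϖ (by rw [hϖ]; exact le_of_lt (WithZero.exp_lt_exp.2 (by norm_num) |>.trans_eq WithZero.exp_zero))
          (uniformizer_ne_zero hϖ) (a + 1)⟩⟩ := by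
  rw [latticeGraph_adj_iff]
  exact Or.inr (latt_apartment_two_succ_lt_selfDual hϖ a)

end Apartment

/-! ## §4 (ED. 2) The apartment edges for ANY vertex witnesses — no `σϖ = ϖ`: the tame-ramified reading -/

section ApartmentAnyWitness

variable {σ : K →+* K} {ϖ : K}

/-- **The edge `L′_a — L_a`, witness-free form**: for ANY proofs `p`, `q` that `L′_a = latt diag(ϖ^a, 1, ϖ^{1−a})` and `L_a = latt diag(ϖ^a, 1, ϖ^{−a})` are vertices
of `latticeGraph σ ϖ J₀` (at an unramified place ★ `isVertexLattice_two∕isSelfDualLattice_latt_diagonal_zpow`, at a tamely ramified one ★ `…_of_v` of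
`UnitaryLatticeTreeApartmentOfInvolution` — or any other), the two vertices are ADJACENT.  The adjacency is strict inclusion of lattices (`latt_apartment_two_lt_selfDual`), which
sees only valuations, so no hypothesis on `σ` is needed. [cite: BruhatTits1972, §10] [cite: Serre1980Trees, II.1.1] -/
theorem latticeGraph_adj_apartment_two_selfDual_of_isVertex (hϖ : Valued.v ϖ = WithZero.exp (-1 : ℤ)) (a : ℤ)
    (p : IsVertex σ ϖ ((StdForm.antidiagonal 3).over K) (latt (Matrix.diagonal ![ϖ ^ a, (1 : K), ϖ ^ (1 - a)])))
    (q : IsVertex σ ϖ ((StdForm.antidiagonal 3).over K) (latt (Matrix.diagonal ![ϖ ^ a, (1 : K), ϖ ^ (-a)]))) :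
    (latticeGraph σ ϖ ((StdForm.antidiagonal 3).over K)).Adj
      ⟨latt (Matrix.diagonal ![ϖ ^ a, (1 : K), ϖ ^ (1 - a)]), p⟩ ⟨latt (Matrix.diagonal ![ϖ ^ a, (1 : K), ϖ ^ (-a)]), q⟩ := by
  rw [latticeGraph_adj_iff]
  exact Or.inl (latt_apartment_two_lt_selfDual hϖ a)

/-- **The edge `L_a — L′_{a+1}`, witness-free form** (same remarks). [cite: BruhatTits1972, §10] [cite: Serre1980Trees, II.1.1] -/
theorem latticeGraph_adj_apartment_selfDual_two_succ_of_isVertex (hϖ : Valued.v ϖ = WithZero.exp (-1 : ℤ)) (a : ℤ)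
    (p : IsVertex σ ϖ ((StdForm.antidiagonal 3).over K) (latt (Matrix.diagonal ![ϖ ^ a, (1 : K), ϖ ^ (-a)])))
    (q : IsVertex σ ϖ ((StdForm.antidiagonal 3).over K) (latt (Matrix.diagonal ![ϖ ^ (a + 1), (1 : K), ϖ ^ (1 - (a + 1))]))) :
    (latticeGraph σ ϖ ((StdForm.antidiagonal 3).over K)).Adj
      ⟨latt (Matrix.diagonal ![ϖ ^ a, (1 : K), ϖ ^ (-a)]), p⟩ ⟨latt (Matrix.diagonal ![ϖ ^ (a + 1), (1 : K), ϖ ^ (1 - (a + 1))]), q⟩ := by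
  rw [latticeGraph_adj_iff]
  exact Or.inr (latt_apartment_two_succ_lt_selfDual hϖ a)

end ApartmentAnyWitness

end Literature.NumberTheory.Automorphic.UnitaryLatticeTree

end
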